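import Summits.BirchSwinnertonDyer.BirchSwinnertonDyer.Theorems.ResidualThetaTransportAtTwoResidualSignedLambdaLowerCMAtTwoStationRValVisiblePrelim
import HarnessLib

/-!
# Station (R) step D′ kit (forward half), §C₀/§C: the EVALUATED VALUE FORMULA `S_w(ψ)·g(ψ) = q·P(ζ_ψ−1)·(μt·L)(ζ_ψ−1)` of a Kato valued class and
# (R₀⁺) POLLACK RIGIDITY — a VAL-invisible value vector (in particular `w = 0`) is never part of a valued class (mod the displayed (H-RIG))

Route `ResidualThetaTransportAtTwo` (RTT), crux RSL_g `ResidualSignedLambdaLowerCMAtTwo` (stmt-BirchSwinnertonDyer-22608), line «onepair» v3g,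
registered KERNEL stub `stub_kzgValueRelation` = station (R) — its load-bearing STEP D′ `π.cvec z ≠ 0` for a Kato valued class (STUB-PLAN rev 29,
S155/T90; port lane of the (R) writer `prover-bsd-wall-tp2-p2x-w3` g18, who consumes this file by name). Width seat `prover-bsd-wall-tp2-p2x-w2` g22
(`--supports 22608 --as helper`, closes nothing). THEOREMS ONLY (no `def`, no instance, no notation, no named fact, no `sorry`). BSD is NOT proved by
any of this; 22608 / 26074 / 24105 stay OPEN / HOLD; nothing here asserts child A / child B / (R).

PORT of the kernel-checked sketch `Cruxes/ResidualThetaCountLowerPureAtTwo/Sketch_sidea_k4_g26.lean` v2 (stub-ideation k4 g26 «assume the opposite: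
the degenerate instances of station (R)»; STUB-PLAN rev 29 row 105), statements and proofs VERBATIM up to the namespace (the zero-tuple audit §A/§A′/§B
of the sketch is not ported); credit: stub-ideation k4 g26 (every statement and proof). The displayed helper hypotheses (H-RIG) / (H-FIN) stay
hypotheses exactly as in the sketch ((H-RIG) = `StationR.Road.eq_zero_of_forall_primitive_tsum_eq_zero`, p722826, discharged by the consumer).

References: [Pollack2003] Cor. 5.11, Prop. 6.9, Prop. 6.18; [Kato2004Asterisque] Thm. 12.5 (1) (pp. 221–222); [Washington1997] §7.1 Prop. 7.2, Thm. 7.3.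
-/

set_option autoImplicit false
-- the Theorems namespace of this sub repeats the summit name by design (D-0017 nested layout)
set_option linter.dupNamespace false
set_option backward.isDefEq.respectTransparency false

noncomputable section

open scoped Classical NumberField

open Polynomial
open Literature.NumberTheory.EllipticCurves Literature.NumberTheory.EllipticCurves.GreenbergSelmer
open Literature.NumberTheory.EllipticCurves.ModularForms
open Literature.NumberTheory.GaloisRepresentations NumberField IsDedekindDomain Field
open GreenbergVatsal2000 Kobayashi2003 Rat.HeightOneSpectrum
open Summit.BirchSwinnertonDyer.Rank1Residual.Additive Summit.BirchSwinnertonDyer.Rank1Residual.Additive.PadicCyclotomicTower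
open Summit.BirchSwinnertonDyer.BirchSwinnertonDyer.Theorems.OnePair
open Summit.BirchSwinnertonDyer.BirchSwinnertonDyer.Theorems

namespace Summit.BirchSwinnertonDyer.BirchSwinnertonDyer.Theorems.ThetaTransport.StationRValVisible

variable {M : ℕ} [NeZero M] (g : CuspForm (CongruenceSubgroup.Gamma0 M) 2) (ι : coeffField g →+* PadicAlgCl 2) (Ω : ℂ)

variable {S : Set (PadicAlgCl 2)} {W : WeierstrassCurve ℚ} [W.IsElliptic] {κ : ZpExtension ℚ 2} {γ : absoluteGaloisGroup ℚ}
  {S₀ : Finset (HeightOneSpectrum (𝓞 ℚ))} {n : ℕ} {ρ : FramedGaloisRep ℚ ↥(padicCoeffIntegers S) 2}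
  {Θ : ∀ v : HeightOneSpectrum (𝓞 ℚ), ((2 : ℕ) : 𝓞 ℚ) ∈ v.asIdeal → (Cofree ρ ↥(padicCoeffField S) ≃+ (Fin n → ↥(W.geomPrimaryTorsion 2)))}
  {hΘ : ∀ v hv (δ : absoluteGaloisGroup (v.adicCompletion ℚ)) m i,
    Θ v hv (resGalOfEmb (closureEmb (K := ℚ) (v.adicCompletion ℚ)) δ • m) i = resGalOfEmb (closureEmb (K := ℚ) (v.adicCompletion ℚ)) δ • Θ v hv m i}
  {I : Kato2004.IwasawaH1DataCoeff (FramedGaloisRep.toGaloisRep ρ) 2 κ γ}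
  {Sg : AddSubgroup (subgroupH1 κ.kerSubgroup (Cofree ρ ↥(padicCoeffField S)))} [Module ↥(padicCoeffIntegers S) ↥Sg]
  (π : OnePairPins S W κ γ S₀ n ρ Θ hΘ I Sg)


/-! ## §C₀ The EVALUATED VALUE FORMULA `S_w(ψ)·g(ψ) = q·P(ζ_ψ−1)·(μt·L)(ζ_ψ−1)` (both signs), the pointwise engine and its converse -/

omit [NeZero M] in
/-- **(EVALUATED VALUE FORMULA, right side; PROVED, sign-agnostic, needs no (VAL)).** If `θ_N(g;Ω)^ι ≡ P · L (mod ω_N)` in `Λ_𝒪 ⊗ ℚ`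
(`IsCongrModOmegaO`; for a Pollack pair `P = (−1)^{N/2+1}ω⁺_N, L = L⁺` at odd `N` and `P = (−1)^{N/2+1}ω⁻_N, L = L⁻` at even `N`) and `ψ` is an
even primitive character mod `2^{N+2}` (`N ≥ 1`, so `ζ_ψ := ψ(5)` has exact order `2^N`), then the right-hand side of (VALρ) at `ψ` is
`q · μt(ζ_ψ − 1) · Σ_a ψ(a) ι[a/2^{N+2}]⁺ = q · P(ζ_ψ − 1) · (μt · L)(ζ_ψ − 1)` in `ℂ₂` (`eval₂_map_mazurTateElementK_eq_sum`,
`IsCongrModOmegaO.eval₂_eq_mul`, `tsum_map_coeff_mul_mul_pow`). [cite: Pollack2003, Prop. 6.9 (proof), Prop. 6.18 (proof)] -/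
theorem valRHS_eq_mul_eval₂_mul_tsum
    {L : IwasawaAlgebraO S} {N : ℕ} (hN : 1 ≤ N) {P : (PadicAlgCl 2)[X]}
    (hcong : IsCongrModOmegaO S N ((mazurTateElementK g Ω 2 N).map ι) ((P : PowerSeries (PadicAlgCl 2)) * iwasawaOToPowerSeries S L))
    (q : PadicAlgCl 2) (μt : IwasawaAlgebraO S)
    (ψ : DirichletCharacter (PadicAlgCl 2) (2 ^ (N + 2))) (hψe : ψ (-1) = 1) (hψp : ψ.IsPrimitive) :
    algebraMap (PadicAlgCl 2) ℂ_[2] q *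
          (∑' k, algebraMap (PadicAlgCl 2) ℂ_[2] ((PowerSeries.coeff k μt : ↥(padicCoeffIntegers S)) : PadicAlgCl 2) *
              (algebraMap (PadicAlgCl 2) ℂ_[2] (ψ (5 : ZMod (2 ^ (N + 2)))) - 1) ^ k) *
        algebraMap (PadicAlgCl 2) ℂ_[2] (∑ a : ZMod (2 ^ (N + 2)), ψ a * ι (plusSymbolK g Ω ((a.val : ℚ) / (2 : ℚ) ^ (N + 2)))) =
      algebraMap (PadicAlgCl 2) ℂ_[2] q *
          P.eval₂ (algebraMap (PadicAlgCl 2) ℂ_[2]) (algebraMap (PadicAlgCl 2) ℂ_[2] (ψ (5 : ZMod (2 ^ (N + 2)))) - 1) *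
        ∑' k, ((algebraMap (PadicAlgCl 2) ℂ_[2]).comp (padicCoeffIntegers S).subtype) (PowerSeries.coeff k (μt * L)) *
          (algebraMap (PadicAlgCl 2) ℂ_[2] (ψ (5 : ZMod (2 ^ (N + 2)))) - 1) ^ k := by
  classical
  have hφn : ∀ x : PadicAlgCl 2, ‖algebraMap (PadicAlgCl 2) ℂ_[2] x‖ = ‖x‖ := fun x ↦ PadicComplex.norm_extends 2 x
  have hbd : ∀ (A : IwasawaAlgebraO S) (k : ℕ),
      ‖((algebraMap (PadicAlgCl 2) ℂ_[2]).comp (padicCoeffIntegers S).subtype) (PowerSeries.coeff k A)‖ ≤ 1 := fun A k ↦ by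
    rw [RingHom.comp_apply, hφn]
    exact (PowerSeries.coeff k A).2.2
  have hζ := isPrimitiveRoot_apply_five hN ψ hψe hψp
  generalize hζdef : algebraMap (PadicAlgCl 2) ℂ_[2] (ψ (5 : ZMod (2 ^ (N + 2)))) = ζ at hζ ⊢
  have hz : ‖ζ - 1‖ < 1 := norm_sub_one_lt_one_of_pow_prime_pow_eq_one (p := 2) hζ.pow_eq_one
  have hzn : (1 + (ζ - 1)) ^ 2 ^ N = 1 := by rw [add_sub_cancel]; exact hζ.pow_eq_one
  have hev := ResidualThetaLayer.IsCongrModOmegaO.eval₂_eq_mul hcong hz hzn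
  set χ : DirichletCharacter ℂ_[2] (2 ^ (N + 2)) := ψ.ringHomComp (algebraMap (PadicAlgCl 2) ℂ_[2]) with hχ
  have hχe : χ.Even := by
    show χ (-1) = 1
    rw [hχ, MulChar.ringHomComp_apply, hψe, map_one]
  have hχ5 : χ (5 : ZMod (2 ^ (N + 2))) = ζ := by
    rw [hχ, MulChar.ringHomComp_apply, hζdef]
  have hθ : ((mazurTateElementK g Ω 2 N).map ι).eval₂ (algebraMap (PadicAlgCl 2) ℂ_[2]) (ζ - 1) =
      algebraMap (PadicAlgCl 2) ℂ_[2]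
        (∑ a : ZMod (2 ^ (N + 2)), ψ a * ι (plusSymbolK g Ω ((a.val : ℚ) / (2 : ℚ) ^ (N + 2)))) := by
    rw [← hχ5, eval₂_map_mazurTateElementK_two g ι Ω χ hχe, map_sum]
    refine Finset.sum_congr rfl fun a _ ↦ ?_
    rw [map_mul, hχ, MulChar.ringHomComp_apply]
  rw [← hθ, hev, tsum_map_coeff_mul_mul_pow ((algebraMap (PadicAlgCl 2) ℂ_[2]).comp (padicCoeffIntegers S).subtype) (hbd μt) (hbd L) hz]
  have hLsum : (∑' k, algebraMap (PadicAlgCl 2) ℂ_[2] (PowerSeries.coeff k (iwasawaOToPowerSeries S L)) * (ζ - 1) ^ k) =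
      ∑' k, ((algebraMap (PadicAlgCl 2) ℂ_[2]).comp (padicCoeffIntegers S).subtype) (PowerSeries.coeff k L) * (ζ - 1) ^ k :=
    tsum_congr fun k ↦ by rw [coeff_iwasawaOToPowerSeries]; rfl
  have hMsum : (∑' k, algebraMap (PadicAlgCl 2) ℂ_[2] ((PowerSeries.coeff k μt : ↥(padicCoeffIntegers S)) : PadicAlgCl 2) * (ζ - 1) ^ k) =
      ∑' k, ((algebraMap (PadicAlgCl 2) ℂ_[2]).comp (padicCoeffIntegers S).subtype) (PowerSeries.coeff k μt) * (ζ - 1) ^ k :=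
    tsum_congr fun k ↦ rfl
  rw [hLsum, hMsum]
  ring

/-- **(VALUE FORMULA, PROVED).** Under `θ_N^ι ≡ P · L (mod ω_N)` and (VALρ) for `(w, q, μt)`: for every even primitive `ψ` mod `2^{N+2}`, `N ≥ 1`,
`S_w(ψ) · g(ψ) = q · P(ζ_ψ − 1) · (μt · L)(ζ_ψ − 1)` in `ℂ₂`, where `S_w(ψ) = Σ_j bO_j Σ_b ψ⁻¹(b) τ_b • w_{N+2,j}` is the twisted Galois sum of the
value vector and `g(ψ)` the Gauss sum. So ON THE VALUE SIDE the only freedom a valued class has at level `N` is the finite zero set of `μt · L^{±}`.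
[cite: Kato2004Asterisque, Thm. 12.5 (1) (pp. 221–222), §15.16 (p. 265)] [cite: Pollack2003, Prop. 6.18 (proof)] -/
theorem twistedSum_mul_gaussSum_eq
    {L : IwasawaAlgebraO S} {N : ℕ} (hN : 1 ≤ N) {P : (PadicAlgCl 2)[X]}
    (hcong : IsCongrModOmegaO S N ((mazurTateElementK g Ω 2 N).map ι) ((P : PowerSeries (PadicAlgCl 2)) * iwasawaOToPowerSeries S L))
    (τ : ∀ m : ℕ, ZMod (2 ^ m) → Field.absoluteGaloisGroup ℚ_[2]) {w : ℕ → Fin π.nb → PadicAlgCl 2} {q : PadicAlgCl 2}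
    {μt : IwasawaAlgebraO S} (hVAL : π.KatoValCoord g ι Ω τ w q μt)
    (ψ : DirichletCharacter (PadicAlgCl 2) (2 ^ (N + 2))) (hψe : ψ (-1) = 1) (hψp : ψ.IsPrimitive) :
    algebraMap (PadicAlgCl 2) ℂ_[2]
        ((∑ j : Fin π.nb, ((π.bO j : ↥(padicCoeffIntegers S)) : PadicAlgCl 2) *
            ∑ b : (ZMod (2 ^ (N + 2)))ˣ, ψ⁻¹ (b : ZMod (2 ^ (N + 2))) * τ (N + 2) (b : ZMod (2 ^ (N + 2))) • w (N + 2) j) *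
          gaussSum ψ (AddChar.zmodChar (2 ^ (N + 2)) (SignedKatoOffTwo.HondaLog.zeta_pow_prime_pow_self (p := 2) (N + 2)))) =
      algebraMap (PadicAlgCl 2) ℂ_[2] q *
          P.eval₂ (algebraMap (PadicAlgCl 2) ℂ_[2]) (algebraMap (PadicAlgCl 2) ℂ_[2] (ψ (5 : ZMod (2 ^ (N + 2)))) - 1) *
        ∑' k, ((algebraMap (PadicAlgCl 2) ℂ_[2]).comp (padicCoeffIntegers S).subtype) (PowerSeries.coeff k (μt * L)) *
          (algebraMap (PadicAlgCl 2) ℂ_[2] (ψ (5 : ZMod (2 ^ (N + 2)))) - 1) ^ k :=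
  (hVAL N ψ hψe hψp).trans (valRHS_eq_mul_eval₂_mul_tsum g ι Ω hN hcong q μt ψ hψe hψp)

/-- **(ENGINE, pointwise; PROVED).** Under `θ_N^ι ≡ P · L (mod ω_N)`, (VALρ) for `(w, q, μt)` with `q ≠ 0`, and `P(ζ_ψ − 1) ≠ 0`
(`eval₂_signedOmegaMinus_ne_zero` / `eval₂_signedOmegaPlus_ne_zero` for a Pollack pair): if the twisted Galois sum of `w` at the even primitive
`ψ` mod `2^{N+2}` VANISHES, then `(μt · L)(ζ_ψ − 1) = 0`. [cite: Kato2004Asterisque, Thm. 12.5 (1) (pp. 221–222)] [cite: Pollack2003, Prop. 6.18 (proof)] -/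
theorem tsum_coeff_mul_eq_zero_of_twistedSum_eq_zero
    {L : IwasawaAlgebraO S} {N : ℕ} (hN : 1 ≤ N) {P : (PadicAlgCl 2)[X]}
    (hcong : IsCongrModOmegaO S N ((mazurTateElementK g Ω 2 N).map ι) ((P : PowerSeries (PadicAlgCl 2)) * iwasawaOToPowerSeries S L))
    (τ : ∀ m : ℕ, ZMod (2 ^ m) → Field.absoluteGaloisGroup ℚ_[2]) {w : ℕ → Fin π.nb → PadicAlgCl 2} {q : PadicAlgCl 2}
    {μt : IwasawaAlgebraO S} (hq : q ≠ 0) (hVAL : π.KatoValCoord g ι Ω τ w q μt)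
    (ψ : DirichletCharacter (PadicAlgCl 2) (2 ^ (N + 2))) (hψe : ψ (-1) = 1) (hψp : ψ.IsPrimitive)
    (hP : P.eval₂ (algebraMap (PadicAlgCl 2) ℂ_[2]) (algebraMap (PadicAlgCl 2) ℂ_[2] (ψ (5 : ZMod (2 ^ (N + 2)))) - 1) ≠ 0)
    (hS : ∑ j : Fin π.nb, ((π.bO j : ↥(padicCoeffIntegers S)) : PadicAlgCl 2) *
        ∑ b : (ZMod (2 ^ (N + 2)))ˣ, ψ⁻¹ (b : ZMod (2 ^ (N + 2))) * τ (N + 2) (b : ZMod (2 ^ (N + 2))) • w (N + 2) j = 0) :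
    ∑' k, ((algebraMap (PadicAlgCl 2) ℂ_[2]).comp (padicCoeffIntegers S).subtype) (PowerSeries.coeff k (μt * L)) *
        (algebraMap (PadicAlgCl 2) ℂ_[2] (ψ (5 : ZMod (2 ^ (N + 2)))) - 1) ^ k = 0 := by
  have hV := twistedSum_mul_gaussSum_eq g ι Ω π hN hcong τ hVAL ψ hψe hψp
  rw [hS, zero_mul, map_zero] at hV
  have hq' : algebraMap (PadicAlgCl 2) ℂ_[2] q ≠ 0 := (_root_.map_ne_zero _).mpr hq
  rcases mul_eq_zero.mp hV.symm with h | h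
  · rcases mul_eq_zero.mp h with h' | h'
    · exact (hq' h').elim
    · exact (hP h').elim
  · exact h

/-- **(CONVERSE — the exact zero locus; PROVED).** Under `θ_N^ι ≡ P · L (mod ω_N)` and (VALρ): if `(μt · L)(ζ_ψ − 1) = 0` and the Gauss sum
`g(ψ) ≠ 0`, the twisted Galois sum of `w` at `ψ` vanishes. With the engine: **`S_w(ψ) = 0 ⟺ (μt · L^{±})(ψ(5) − 1) = 0`** at every even primitive
`ψ` of conductor `2^{N+2}`, `N ≥ 1` — the VAL-visible zero locus of a valued class is EXACTLY the zero divisor of `μt · L^{±}` on the cyclotomic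
points. (`g(ψ) ≠ 0` for primitive `ψ` at prime-power modulus: `g(ψ) g(ψ̄) = ψ(−1) 2^{N+2}`; the tree has it over `ℂ` as
`LargeSieve.gaussSum_mul_gaussSum_inv`, the `ℚ̄₂`-valued port is plan helper (P-GAUSS).) [cite: Kato2004Asterisque, Thm. 12.5 (1)] [cite: Washington1997, Lemma 4.8] -/
theorem twistedSum_eq_zero_of_tsum_coeff_mul_eq_zero
    {L : IwasawaAlgebraO S} {N : ℕ} (hN : 1 ≤ N) {P : (PadicAlgCl 2)[X]}
    (hcong : IsCongrModOmegaO S N ((mazurTateElementK g Ω 2 N).map ι) ((P : PowerSeries (PadicAlgCl 2)) * iwasawaOToPowerSeries S L))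
    (τ : ∀ m : ℕ, ZMod (2 ^ m) → Field.absoluteGaloisGroup ℚ_[2]) {w : ℕ → Fin π.nb → PadicAlgCl 2} {q : PadicAlgCl 2}
    {μt : IwasawaAlgebraO S} (hVAL : π.KatoValCoord g ι Ω τ w q μt)
    (ψ : DirichletCharacter (PadicAlgCl 2) (2 ^ (N + 2))) (hψe : ψ (-1) = 1) (hψp : ψ.IsPrimitive)
    (hg : gaussSum ψ (AddChar.zmodChar (2 ^ (N + 2)) (SignedKatoOffTwo.HondaLog.zeta_pow_prime_pow_self (p := 2) (N + 2))) ≠ 0)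
    (hT : ∑' k, ((algebraMap (PadicAlgCl 2) ℂ_[2]).comp (padicCoeffIntegers S).subtype) (PowerSeries.coeff k (μt * L)) *
        (algebraMap (PadicAlgCl 2) ℂ_[2] (ψ (5 : ZMod (2 ^ (N + 2)))) - 1) ^ k = 0) :
    ∑ j : Fin π.nb, ((π.bO j : ↥(padicCoeffIntegers S)) : PadicAlgCl 2) *
        ∑ b : (ZMod (2 ^ (N + 2)))ˣ, ψ⁻¹ (b : ZMod (2 ^ (N + 2))) * τ (N + 2) (b : ZMod (2 ^ (N + 2))) • w (N + 2) j = 0 := by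
  have hV := twistedSum_mul_gaussSum_eq g ι Ω π hN hcong τ hVAL ψ hψe hψp
  rw [hT, mul_zero, map_eq_zero_iff _ (algebraMap (PadicAlgCl 2) ℂ_[2]).injective] at hV
  exact (mul_eq_zero.mp hV).resolve_right hg

/-! ## §C (R₀) — Pollack rigidity: a VAL-invisible value vector (in particular `w = 0`) is never part of a valued class -/

set_option maxHeartbeats 1600000 in
/-- **(R₀⁺) Pollack rigidity (PROVED from two cyclotomic helpers).** With `L⁻ ≠ 0` and the EVEN half of a Pollack pair for `(g, ι, Ω)`
(`θ_N ≡ (−1)^{N/2+1} ω⁻_N L⁻ (mod ω_N)` in `Λ_𝒪 ⊗ ℚ`, `N` even — `IsPollackPairK g ι Ω Lp Lm` `.2.2.2` / `.2.1` when `S = range ι`), NO tuple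
`(z, c′, w, q, μt)` whose value vector `w` is VAL-INVISIBLE at the even levels (all twisted Galois sums `Σ_j bO_j Σ_b ψ⁻¹(b) τ_b • w_{m+2,j}`
vanish for `m` even, `ψ` even primitive) is a Kato valued class — in particular none with `w = 0`, none with Galois-fixed values. Helpers:
(H-CHAR) every primitive `2^N`-th root of unity in `ℂ₂` (`N ≥ 1`) is `ψ(5)` for an even primitive `ℚ̄₂`-valued `ψ` mod `2^{N+2}` — PROVED
above (`exists_even_primitive_apply_five_eq`); (H-RIG, displayed as a hypothesis) an element of `Λ_𝒪` vanishing at `ζ − 1` for all primitive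
`ζ` of order `2^{ℓ_i+1}` along an unbounded family `ℓ_i` is `0` (k3-g25 `eq_zero_of_forall_primitive_tsum_eq_zero`, Weierstrass division). MECHANISM: VAL at `ψ_ζ` gives `μt(ζ−1) · Λ_g(ψ_ζ) = 0`; the
even congruence evaluated (`IsCongrModOmegaO.eval₂_eq_mul`, `eval₂_map_mazurTateElementK_eq_sum`) gives `Λ_g(ψ_ζ) = ±ω⁻_N(ζ−1) L⁻(ζ−1)`
with `ω⁻_N(ζ−1) ≠ 0`; so `(μt · L⁻)(ζ−1) = 0` at all primitive `ζ` of order `2^N`, `N` even; rigidity gives `μt · L⁻ = 0`: absurd.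
[cite: Pollack2003, Cor. 5.11, Prop. 6.18 (proof)] [cite: Kato2004Asterisque, Thm. 12.5 (1) (pp. 221–222)] [cite: Washington1997, §7.1 Prop. 7.2, Thm. 7.3] -/
theorem not_katoValuedClass_of_valInvisible [W.IsGloballyMinimal]
    {Lm : IwasawaAlgebraO S} (hLm : Lm ≠ 0)
    (hcong : ∀ N : ℕ, Even N →
      IsCongrModOmegaO S N ((mazurTateElementK g Ω 2 N).map ι)
        (((((-1 : ℤ[X]) ^ (N / 2 + 1) * cyclotomicOmegaMinus 2 N).map (Int.castRingHom (PadicAlgCl 2)) : (PadicAlgCl 2)[X]) :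
            PowerSeries (PadicAlgCl 2)) * iwasawaOToPowerSeries S Lm))
    (hRIG : ∀ (G : IwasawaAlgebraO S) (ℓ : ℕ → ℕ), (∀ m : ℕ, ∃ i, m < ℓ i) →
      (∀ (i : ℕ) (ζ : ℂ_[2]), IsPrimitiveRoot ζ (2 ^ (ℓ i + 1)) →
        ∑' k, ((algebraMap (PadicAlgCl 2) ℂ_[2]).comp (padicCoeffIntegers S).subtype) (PowerSeries.coeff k G) * (ζ - 1) ^ k = 0) →
      G = 0)
    (Φ : AlgebraicClosure ℚ_[2] ≃ₐ[ℚ] AlgebraicClosure (π.v.adicCompletion ℚ))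
    (τ : ∀ m : ℕ, ZMod (2 ^ m) → Field.absoluteGaloisGroup ℚ_[2]) (z : I.H) (c' : Fin n → ↥(padicCoeffIntegers S))
    (w : ℕ → Fin π.nb → PadicAlgCl 2) (q : PadicAlgCl 2) (μt : IwasawaAlgebraO S)
    (hw : ∀ (m : ℕ) (ψ : DirichletCharacter (PadicAlgCl 2) (2 ^ (m + 2))), ψ (-1) = 1 → ψ.IsPrimitive → Even m →
      ∑ j : Fin π.nb, ((π.bO j : ↥(padicCoeffIntegers S)) : PadicAlgCl 2) *
          ∑ b : (ZMod (2 ^ (m + 2)))ˣ, ψ⁻¹ (b : ZMod (2 ^ (m + 2))) * τ (m + 2) (b : ZMod (2 ^ (m + 2))) • w (m + 2) j = 0) :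
    ¬ π.KatoValuedClass g ι Ω Φ τ z c' w q μt := by
  rintro ⟨hq, hμ, -, -, hVAL, -⟩
  -- the product `μt · L⁻` vanishes at every `ζ − 1`, `ζ` of exact order `2^{2i+2}`: (H-CHAR) supplies `ψ` with `ψ(5) = ζ`, the ENGINE does the rest
  have key : μt * Lm = 0 := by
    refine hRIG (μt * Lm) (fun i ↦ 2 * i + 1) (fun m ↦ ⟨m, by omega⟩) fun i ζ hζ ↦ ?_
    have hN : 2 * i + 1 + 1 = 2 * i + 2 := by ring
    rw [hN] at hζ
    obtain ⟨ψ, hψe, hψp, hψ5⟩ := exists_even_primitive_apply_five_eq (2 * i + 2) ζ (by omega) hζ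
    have h := tsum_coeff_mul_eq_zero_of_twistedSum_eq_zero g ι Ω π (N := 2 * i + 2) (by omega) (hcong (2 * i + 2) ⟨i + 1, by ring⟩)
      τ hq hVAL ψ hψe hψp (by rw [hψ5]; exact eval₂_signedOmegaMinus_ne_zero (N := 2 * i + 2) ⟨i + 1, by ring⟩ hζ)
      (hw (2 * i + 2) ψ hψe hψp ⟨i + 1, by ring⟩)
    rwa [hψ5] at h
  rcases mul_eq_zero.mp key with h0 | h0
  · exact hμ h0
  · exact hLm h0

/-- **(R₀) the case `w = 0`** (any `z`): the zero value vector is never part of a Kato valued class. [cite: Pollack2003, Cor. 5.11, Prop. 6.18 (proof)]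
[cite: Kato2004Asterisque, Thm. 12.5 (1) (pp. 221–222)] -/
theorem not_katoValuedClass_w_zero [W.IsGloballyMinimal]
    {Lm : IwasawaAlgebraO S} (hLm : Lm ≠ 0)
    (hcong : ∀ N : ℕ, Even N →
      IsCongrModOmegaO S N ((mazurTateElementK g Ω 2 N).map ι)
        (((((-1 : ℤ[X]) ^ (N / 2 + 1) * cyclotomicOmegaMinus 2 N).map (Int.castRingHom (PadicAlgCl 2)) : (PadicAlgCl 2)[X]) :
            PowerSeries (PadicAlgCl 2)) * iwasawaOToPowerSeries S Lm))
    (hRIG : ∀ (G : IwasawaAlgebraO S) (ℓ : ℕ → ℕ), (∀ m : ℕ, ∃ i, m < ℓ i) →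
      (∀ (i : ℕ) (ζ : ℂ_[2]), IsPrimitiveRoot ζ (2 ^ (ℓ i + 1)) →
        ∑' k, ((algebraMap (PadicAlgCl 2) ℂ_[2]).comp (padicCoeffIntegers S).subtype) (PowerSeries.coeff k G) * (ζ - 1) ^ k = 0) →
      G = 0)
    (Φ : AlgebraicClosure ℚ_[2] ≃ₐ[ℚ] AlgebraicClosure (π.v.adicCompletion ℚ))
    (τ : ∀ m : ℕ, ZMod (2 ^ m) → Field.absoluteGaloisGroup ℚ_[2]) (z : I.H) (c' : Fin n → ↥(padicCoeffIntegers S))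
    (q : PadicAlgCl 2) (μt : IwasawaAlgebraO S) :
    ¬ π.KatoValuedClass g ι Ω Φ τ z c' 0 q μt :=
  not_katoValuedClass_of_valInvisible g ι Ω π hLm hcong hRIG Φ τ z c' 0 q μt fun m ψ _ _ _ ↦ by
    simp only [Pi.zero_apply, smul_zero, mul_zero, Finset.sum_const_zero]

/-- **Contrapositive: the value vector of a Kato valued class is WILD** — some twisted Galois sum at an even level is nonzero (what station (R)'s
`ν ≠ 0` will need on the value side). [cite: Kato2004Asterisque, Thm. 12.5 (1) (pp. 221–222)] [cite: Pollack2003, Cor. 5.11] -/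
theorem exists_twistedSum_ne_zero_of_katoValuedClass [W.IsGloballyMinimal]
    {Lm : IwasawaAlgebraO S} (hLm : Lm ≠ 0)
    (hcong : ∀ N : ℕ, Even N →
      IsCongrModOmegaO S N ((mazurTateElementK g Ω 2 N).map ι)
        (((((-1 : ℤ[X]) ^ (N / 2 + 1) * cyclotomicOmegaMinus 2 N).map (Int.castRingHom (PadicAlgCl 2)) : (PadicAlgCl 2)[X]) :
            PowerSeries (PadicAlgCl 2)) * iwasawaOToPowerSeries S Lm))
    (hRIG : ∀ (G : IwasawaAlgebraO S) (ℓ : ℕ → ℕ), (∀ m : ℕ, ∃ i, m < ℓ i) →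
      (∀ (i : ℕ) (ζ : ℂ_[2]), IsPrimitiveRoot ζ (2 ^ (ℓ i + 1)) →
        ∑' k, ((algebraMap (PadicAlgCl 2) ℂ_[2]).comp (padicCoeffIntegers S).subtype) (PowerSeries.coeff k G) * (ζ - 1) ^ k = 0) →
      G = 0)
    {Φ : AlgebraicClosure ℚ_[2] ≃ₐ[ℚ] AlgebraicClosure (π.v.adicCompletion ℚ)}
    {τ : ∀ m : ℕ, ZMod (2 ^ m) → Field.absoluteGaloisGroup ℚ_[2]} {z : I.H} {c' : Fin n → ↥(padicCoeffIntegers S)}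
    {w : ℕ → Fin π.nb → PadicAlgCl 2} {q : PadicAlgCl 2} {μt : IwasawaAlgebraO S}
    (hcl : π.KatoValuedClass g ι Ω Φ τ z c' w q μt) :
    ∃ (m : ℕ) (ψ : DirichletCharacter (PadicAlgCl 2) (2 ^ (m + 2))), ψ (-1) = 1 ∧ ψ.IsPrimitive ∧ Even m ∧
      ∑ j : Fin π.nb, ((π.bO j : ↥(padicCoeffIntegers S)) : PadicAlgCl 2) *
          ∑ b : (ZMod (2 ^ (m + 2)))ˣ, ψ⁻¹ (b : ZMod (2 ^ (m + 2))) * τ (m + 2) (b : ZMod (2 ^ (m + 2))) • w (m + 2) j ≠ 0 := by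
  by_contra h
  refine not_katoValuedClass_of_valInvisible g ι Ω π hLm hcong hRIG Φ τ z c' w q μt (fun m ψ h1 h2 h3 ↦ ?_) hcl
  by_contra h'
  exact h ⟨m, ψ, h1, h2, h3, h'⟩

/-- **Corollary: station (R) holds on the whole slice `w = 0`** (vacuously — its guard is never met there), for every `e`, under the
hypotheses of `not_katoValuedClass_of_valInvisible`. [cite: Kato2004Asterisque, Thm. 12.5 (1)–(2) (pp. 221–222)] [cite: Pollack2003, Cor. 5.11] -/
theorem stationR_at_w_zero [W.IsGloballyMinimal]
    {Lm : IwasawaAlgebraO S} (hLm : Lm ≠ 0)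
    (hcong : ∀ N : ℕ, Even N →
      IsCongrModOmegaO S N ((mazurTateElementK g Ω 2 N).map ι)
        (((((-1 : ℤ[X]) ^ (N / 2 + 1) * cyclotomicOmegaMinus 2 N).map (Int.castRingHom (PadicAlgCl 2)) : (PadicAlgCl 2)[X]) :
            PowerSeries (PadicAlgCl 2)) * iwasawaOToPowerSeries S Lm))
    (hRIG : ∀ (G : IwasawaAlgebraO S) (ℓ : ℕ → ℕ), (∀ m : ℕ, ∃ i, m < ℓ i) →
      (∀ (i : ℕ) (ζ : ℂ_[2]), IsPrimitiveRoot ζ (2 ^ (ℓ i + 1)) →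
        ∑' k, ((algebraMap (PadicAlgCl 2) ℂ_[2]).comp (padicCoeffIntegers S).subtype) (PowerSeries.coeff k G) * (ζ - 1) ^ k = 0) →
      G = 0)
    (Φ : AlgebraicClosure ℚ_[2] ≃ₐ[ℚ] AlgebraicClosure (π.v.adicCompletion ℚ))
    (τ : ∀ m : ℕ, ZMod (2 ^ m) → Field.absoluteGaloisGroup ℚ_[2]) (z : I.H) (c' : Fin n → ↥(padicCoeffIntegers S))
    (q : PadicAlgCl 2) (μt : IwasawaAlgebraO S) (hcl : π.KatoValuedClass g ι Ω Φ τ z c' 0 q μt)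
    (e : (Fin n → PowerSeries ℤ_[2]) ≃+ IwasawaAlgebraO S) :
    ∃ (ν : ↥(padicCoeffIntegers S)) (u : IwasawaAlgebraO S), ν ≠ 0 ∧ u ≠ 0 ∧ PowerSeries.C ν * e (π.cvec z) = μt * (Lm * u) :=
  (not_katoValuedClass_w_zero g ι Ω π hLm hcong hRIG Φ τ z c' q μt hcl).elim


end Summit.BirchSwinnertonDyer.BirchSwinnertonDyer.Theorems.ThetaTransport.StationRValVisible

end
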